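import Summits.QuantumFields.YangMills.Theorems.UnitScaleTiltProp7CovLineFaceTrace
import Summits.QuantumFields.YangMills.Theorems.UnitScaleTiltProp7BlockLineCount
import Summits.QuantumFields.YangMills.Theorems.UnitScaleTiltProp7TwoWordStokes
import Summits.QuantumFields.YangMills.Theorems.UnitScaleTiltProp7CovCombMeanFrames
import Summits.QuantumFields.YangMills.Theorems.UnitScaleTiltProp7CovRightInverse
import HarnessLib

/-!
# Route `UnitScaleTilt`, crux K1 «MinimiserStabilityRegPr» (stmt-QuantumFields-19200), route-R E′ S3 K-form engine (DESIGN-S3-KFORM-ENGINE-g15) — ROW R3′, GAUSS ROW (hX), FACE PIECE (G1)–(G2):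
# the per-line face functional of the R3′ door (face value transported back ALONG ITS LINE, then by the comb) and the comb-direct face functional (the outflow letter of the covariant
# Gauss law ✓ `Prop7CovCombGauss`) differ by an `e`-small transport defect that HITS `B` AT THE FACE, hence is paid by the 1-D trace: `Σ_c‖FACE_c − FACE′_c‖² ≤ C·(ℓ²δ)²·(ℓ^{2−d}M + ℓ^{4−d}G_long)`

Cell `ym3-torus`, width seat `ym3-torus-px17` (gen 2; LOCATE-R3PRIME-COVFACEFLUX-px17g2.md §3 (G1)(G2), §0.1 (F)).  THEOREMS ONLY (0 `def`, 0 `sorry`); `--supports stmt-QuantumFields-19200`,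
count-neutral.  YM₃ on T³ is a ladder rung (R3), not the Clay problem; nothing here claims a stub, the crux, d = 4 or the mass gap.

WHY.  In the R3′ door ✓p669468 `Prop7CovFaceFluxRow.sum_normSq_centreDiff_le_of_rows` the Gauss row `hX` pairs the coarse covariant differences with `FACE_c`, whose transports are the
line's (so that the (E)-row ✓p669695 is junk-free), while the covariant Gauss law ✓p669014 produces the outflow with the COMB transport to the face point itself.  The two transports are two
words of length `≤ (2d+1)ℓ` from the block corner with the same end, so ✓ `Prop7TwoWordStokes.norm_conj_holAt_sub_conj_holAt_le` (perimeter Stokes, `PlaqSmall δ`) makes them agree up to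
`((2d+1)ℓ)²∕2·δ` — with `δ = eℓ⁻²` an `e`-small RELATIVE defect acting on the face values of `B`; squared and summed it is the face mass, which ✓p669005
`Prop7CovLineFaceTrace.normSq_apply_le_line_trace` books by `2ℓ⁻¹·(mass) + 2ℓ·(longitudinal gradient)` line by line (✓ `Prop7BlockLineCount.sum_block_lines` counts the lines).

WHAT IS PROVED (ns `…Theorems.Prop7CovFaceFluxFacePiece`; `SU(N)` background `W` on the finest torus, read as units `unitsField (toUField W)`; block offsets `Site.fibreSite 0 k y r`).
* §1 `netDisp_treeWord_append_replicate` (the comb-then-line word and the comb word to the line's point have the same net displacement), `holT_treeWord_mul_holT_replicate` (the product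
  transport IS the transport of the concatenated word), ★ `norm_conjR_combLine_sub_conjR_comb_le` — `‖R(comb·line)X − R(comb′)X‖ ≤ (((2d+1)L^k)²∕2)·δ·‖X‖`.
* §2 ★★ `sum_normSq_faceFun_sub_combFaceFun_le` — summed over the `k`-bonds with contractive frame changes `gL_c, gR_c`:
  `Σ_c ‖V_k⁻¹•(gL_c·(ℓ•FACE_c)·gR_c) − V_k⁻¹•(gL_c·(ℓ•FACE′_c)·gR_c)‖² ≤ ((2d+1)L^k)⁴·δ²·ℓ²·V_k⁻¹·(M(Y) + ℓ²·G_long,W(Y))` (`V_k = ℓ^d`; at `d = 3`, `δ = eℓ⁻²`: `(2d+1)⁴·e²·(ℓ⁻¹M + ℓG_long)`).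
HONEST SCOPE.  Transport kinematics + the landed perimeter Stokes; no displayed row; nothing of Bałaban's asserted.  The identification of `FACE′` with the outflow of ✓p669014 at `S :=` the block
(face layer = `{x ∈ S : x + e_μ ∉ S}`) and the rest of `hX` are elsewhere.

References: T. Bałaban, CMP 98 (1985) 17–51 [Balaban1985Averaging] ((9) p.18, (19)–(20) p.21, pp.24–25); CMP 95 (1984) 17–40 [Balaban1984PropagatorsI] ((1.18)–(1.21) pp.20–21);
CMP 102 (1985) 277–309 [Balaban1985Variational] (Prop. 7 p.299, (6) p.278).
-/

set_option autoImplicit false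

noncomputable section

open scoped BigOperators Matrix.Norms.L2Operator

namespace Summit.QuantumFields.YangMills.Theorems.Prop7CovFaceFluxFacePiece

open Literature.MathematicalPhysics.QuantumFieldTheory.Balaban1983to89
open Finset T4Continuum
open B7Prop1Explicit (U1 treeWord l1 e disp disp_treeWord disp_append disp_replicate length_treeWord)
open B7Eq78Linearization (conjR)
open B10Eq27TorusAxialLog (holT unitsField toUField holT_append)
open Summit.QuantumFields.YangMills.Theorems.Prop7CovLineFaceTrace (normSq_apply_le_line_trace)
open Summit.QuantumFields.YangMills.Theorems.Prop7BlockLineCount (sum_block_lines)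
open Summit.QuantumFields.YangMills.Theorems.Prop7TwoWordStokes (norm_conj_holAt_sub_conj_holAt_le)
open Summit.QuantumFields.YangMills.Theorems.Prop7CovCombMeanFrames (conjR_holT_su)
open Summit.QuantumFields.YangMills.Theorems.Prop7CovCombMeanFrames (disp_apply_eq_netDisp)
open Summit.QuantumFields.YangMills.Theorems.Prop7CovRightInverse (fibreSite_eq_transl l1_intVec_le')

variable {P : Params} {k : ℕ} {N : ℕ} [NeZero N]

/-! ## §1 One line: comb-then-line versus comb-direct -/

omit [NeZero N] in
/-- The comb word to the offset `r` followed by `t` forward `μ`-steps and the comb word to the offset `r + te_μ` have the same net displacement. [folklore] -/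
theorem netDisp_treeWord_append_replicate (r : Fin P.d → ℤ) (μ : Fin P.d) (t : ℕ) (ν : Fin P.d) :
    netDisp (treeWord r ++ List.replicate t (μ, true)) ν = netDisp (treeWord (r + (t : ℤ) • e μ)) ν := by
  rw [← disp_apply_eq_netDisp, ← disp_apply_eq_netDisp, disp_append, disp_treeWord, disp_treeWord, disp_replicate, B7Prop1Explicit.Letter.vec_true]

omit [NeZero N] in
/-- THE PRODUCT TRANSPORT IS THE TRANSPORT OF THE CONCATENATED WORD: `V(Γ_{ȳ,x_r})·V([x_r, x_r + te_μ]) = V(Γ_{ȳ,x_r} ∪ [x_r, x_r+te_μ])` (✓ `holT_append`, `x_r = ȳ + r`).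
[cite: Balaban1985Averaging, (9) p.18] -/
theorem holT_treeWord_mul_holT_replicate (V : GaugeField P 0 (Matrix (Fin N) (Fin N) ℂ)ˣ) (y : Site P k) (r : Fin P.d → Fin (P.L ^ k)) (μ : Fin P.d) (t : ℕ) :
    holT V (Site.fibreSite 0 k y fun _ => ⟨0, pow_pos P.L_pos k⟩) (treeWord fun ν => ((r ν : ℕ) : ℤ)) * holT V (Site.fibreSite 0 k y r) (List.replicate t (μ, true))
      = holT V (Site.fibreSite 0 k y fun _ => ⟨0, pow_pos P.L_pos k⟩) (treeWord (fun ν => ((r ν : ℕ) : ℤ)) ++ List.replicate t (μ, true)) := by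
  rw [holT_append, disp_treeWord, ← fibreSite_eq_transl]

/-- ★ **COMB-THEN-LINE VERSUS COMB-DIRECT, ONE VALUE**: with `PlaqSmall δ W` (`δ ≥ 0`), for every block offset `r`, direction `μ`, `t` with `r_μ + t < L^k`, and every `X`,
`‖R(V(Γ_{ȳ,x_r})V([x_r, x_r+te_μ]))X − R(V(Γ_{ȳ, x_r+te_μ}))X‖ ≤ (((2d+1)·L^k)²∕2)·δ·‖X‖` — perimeter Stokes ✓ `Prop7TwoWordStokes.norm_conj_holAt_sub_conj_holAt_le` for the two words
(lengths `≤ dL^k + L^k` and `≤ dL^k`). [cite: Balaban1985Averaging, (19)-(20) p.21, pp.24-25] -/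
theorem norm_conjR_combLine_sub_conjR_comb_le (W : GaugeField P 0 (Matrix.specialUnitaryGroup (Fin N) ℂ)) {δ : ℝ} (hδ : 0 ≤ δ) (hW : PlaqSmall δ W)
    (y : Site P k) (r : Fin P.d → Fin (P.L ^ k)) (μ : Fin P.d) (t : ℕ) (s' : Fin (P.L ^ k)) (hs' : (s' : ℕ) = (r μ : ℕ) + t) (X : Matrix (Fin N) (Fin N) ℂ) :
    ‖conjR (holT (unitsField (toUField W)) (Site.fibreSite 0 k y fun _ => ⟨0, pow_pos P.L_pos k⟩) (treeWord fun ν => ((r ν : ℕ) : ℤ))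
          * holT (unitsField (toUField W)) (Site.fibreSite 0 k y r) (List.replicate t (μ, true))) X
        - conjR (holT (unitsField (toUField W)) (Site.fibreSite 0 k y fun _ => ⟨0, pow_pos P.L_pos k⟩) (treeWord fun ν => ((Function.update r μ s' ν : ℕ) : ℤ))) X‖
      ≤ ((((2 * P.d + 1) * P.L ^ k : ℕ) : ℝ) ^ 2 / 2) * δ * ‖X‖ := by
  rw [holT_treeWord_mul_holT_replicate, conjR_holT_su, conjR_holT_su]
  -- the two words and their net displacements
  have hupd : (fun ν => ((Function.update r μ s' ν : ℕ) : ℤ)) = (fun ν => ((r ν : ℕ) : ℤ)) + (t : ℤ) • e μ := by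
    funext ν
    simp only [Pi.add_apply, Pi.smul_apply, B7Prop1Explicit.e_apply, smul_eq_mul]
    by_cases hν : ν = μ
    · subst hν; rw [Function.update_self, if_pos rfl, hs']; push_cast; ring
    · rw [Function.update_of_ne hν, if_neg hν, mul_zero, add_zero]
  have hnd : ∀ ν, netDisp (treeWord (fun ν => ((r ν : ℕ) : ℤ)) ++ List.replicate t (μ, true)) ν
      = netDisp (treeWord fun ν => ((Function.update r μ s' ν : ℕ) : ℤ)) ν := by
    intro ν; rw [netDisp_treeWord_append_replicate, hupd]
  refine (norm_conj_holAt_sub_conj_holAt_le W hδ hW _ _ _ hnd X).trans (mul_le_mul_of_nonneg_right (mul_le_mul_of_nonneg_right ?_ hδ) (norm_nonneg _))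
  -- lengths: `|Γ_r| + t ≤ dL^k + L^k`, `|Γ_{r'}| ≤ dL^k`
  have hlen1 : ((treeWord (fun ν => ((r ν : ℕ) : ℤ)) ++ List.replicate t (μ, true)).length : ℝ) ≤ P.d * (P.L : ℝ) ^ k + (P.L : ℝ) ^ k := by
    rw [List.length_append, List.length_replicate, length_treeWord]
    push_cast
    have ht : (t : ℝ) ≤ (P.L : ℝ) ^ k := by
      have : t ≤ P.L ^ k := by have := s'.isLt; omega
      exact_mod_cast this
    linarith [l1_intVec_le' (P := P) (k := k) r]
  have hlen2 : ((treeWord fun ν => ((Function.update r μ s' ν : ℕ) : ℤ)).length : ℝ) ≤ P.d * (P.L : ℝ) ^ k := by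
    rw [length_treeWord]; exact l1_intVec_le' _
  have hsum : (((treeWord (fun ν => ((r ν : ℕ) : ℤ)) ++ List.replicate t (μ, true)).length
      + (treeWord fun ν => ((Function.update r μ s' ν : ℕ) : ℤ)).length : ℕ) : ℝ) ≤ (((2 * P.d + 1) * P.L ^ k : ℕ) : ℝ) := by
    push_cast at hlen1 hlen2 ⊢
    linarith
  have h0 : (0 : ℝ) ≤ (((treeWord (fun ν => ((r ν : ℕ) : ℤ)) ++ List.replicate t (μ, true)).length
      + (treeWord fun ν => ((Function.update r μ s' ν : ℕ) : ℤ)).length : ℕ) : ℝ) := by positivity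
  have := pow_le_pow_left₀ h0 hsum 2
  linarith [this]

/-! ## §2 The block sum: the face piece of the Gauss row -/

/-- ★★ **THE FACE PIECE (G1)–(G2) OF THE GAUSS ROW**: with `PlaqSmall δ W`, contractions `gL_c, gR_c`, and per line the far-face index `t₀ = L^k − 1 − r_{μ_c}` (any `t₀ c r` with
`r_μ + t₀ c r < L^k` is allowed), the per-line face functional `FACE_c = Σ_r R(comb_r·line_{r,t₀})Y(face_r)` and the comb-direct one `FACE′_c = Σ_r R(comb_{face_r})Y(face_r)` satisfy
`Σ_c ‖V_k⁻¹•(gL_c(ℓ•FACE_c)gR_c) − V_k⁻¹•(gL_c(ℓ•FACE′_c)gR_c)‖² ≤ (((2d+1)ℓ)²∕2·δ)²·2·ℓ²V_k⁻¹·(M(Y) + ℓ²·G_long,W(Y))` (`ℓ = L^k`, `V_k = ℓ^d`; `δ = eℓ⁻²`, `d = 3`: `≤ 2401∕2·e²·(ℓ⁻¹M + ℓG_long)`) —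
the defect hits `Y` at the face and is paid by the 1-D trace ✓p669005. [cite: Balaban1985Averaging, (19)-(20) p.21; Balaban1984PropagatorsI, (1.21) p.21; Balaban1985Variational, (6) p.278, Prop. 7 p.299] -/
theorem sum_normSq_faceFun_sub_combFaceFun_le (h : P.sitesPerDir 0 = P.L ^ k * P.sitesPerDir k)
    (W : GaugeField P 0 (Matrix.specialUnitaryGroup (Fin N) ℂ)) {δ : ℝ} (hδ : 0 ≤ δ) (hW : PlaqSmall δ W)
    (gL gR : PBond P k → Matrix (Fin N) (Fin N) ℂ) (hgL : ∀ c, ‖gL c‖ ≤ 1) (hgR : ∀ c, ‖gR c‖ ≤ 1)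
    (t₀ : PBond P k → (Fin P.d → Fin (P.L ^ k)) → ℕ) (s' : PBond P k → (Fin P.d → Fin (P.L ^ k)) → Fin (P.L ^ k))
    (hs' : ∀ c r, ((s' c r : ℕ)) = (r c.dir : ℕ) + t₀ c r)
    (Y : PBond P 0 → Matrix (Fin N) (Fin N) ℂ) :
    ∑ c : PBond P k, ‖(((P.L : ℝ) ^ k) ^ P.d)⁻¹ • (gL c * (((P.L : ℝ) ^ k) • ∑ r : Fin P.d → Fin (P.L ^ k),
            conjR (holT (unitsField (toUField W)) (Site.fibreSite 0 k c.src fun _ => ⟨0, pow_pos P.L_pos k⟩) (treeWord fun ν => ((r ν : ℕ) : ℤ))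
                * holT (unitsField (toUField W)) (Site.fibreSite 0 k c.src r) (List.replicate (t₀ c r) (c.dir, true)))
              (Y ⟨(fun z : Site P 0 => z.shift c.dir)^[t₀ c r] (Site.fibreSite 0 k c.src r), c.dir⟩)) * gR c)
        - (((P.L : ℝ) ^ k) ^ P.d)⁻¹ • (gL c * (((P.L : ℝ) ^ k) • ∑ r : Fin P.d → Fin (P.L ^ k),
            conjR (holT (unitsField (toUField W)) (Site.fibreSite 0 k c.src fun _ => ⟨0, pow_pos P.L_pos k⟩) (treeWord fun ν => ((Function.update r c.dir (s' c r) ν : ℕ) : ℤ)))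
              (Y ⟨(fun z : Site P 0 => z.shift c.dir)^[t₀ c r] (Site.fibreSite 0 k c.src r), c.dir⟩)) * gR c)‖ ^ 2
      ≤ (((((2 * P.d + 1) * P.L ^ k : ℕ) : ℝ) ^ 2 / 2) * δ) ^ 2 * 2 * ((P.L : ℝ) ^ k) ^ 2 * (((P.L : ℝ) ^ k) ^ P.d)⁻¹ *
          (∑ b : PBond P 0, ‖Y b‖ ^ 2 + ((P.L : ℝ) ^ k) ^ 2 * ∑ b : PBond P 0, ‖conjR (unitsField (toUField W) b) (Y ⟨b.src.shift b.dir, b.dir⟩) - Y b‖ ^ 2) := by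
  classical
  -- the background in units is `U1`-valued
  letI : CStarAlgebra (Matrix (Fin N) (Fin N) ℂ) := B10Eq29TubeLine.cstarAlgebraMatrix N
  have hV : ∀ b, unitsField (toUField W) b ∈ U1 (Matrix (Fin N) (Fin N) ℂ) :=
    fun b => B7Prop2Explicit.unitaryUnits_le_U1 (B10Eq27TorusAxialLog.unitsField_mem_unitaryUnits (toUField W) b)
  -- scalar letters
  set ℓ : ℝ := (P.L : ℝ) ^ k with hℓ
  set Vk : ℝ := ((P.L : ℝ) ^ k) ^ P.d with hVk
  set C : ℝ := ((((2 * P.d + 1) * P.L ^ k : ℕ) : ℝ) ^ 2 / 2) * δ with hC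
  have hL0 : (0 : ℝ) < P.L := by exact_mod_cast P.L_pos
  have hℓ0 : 0 < ℓ := by positivity
  have hVk0 : 0 < Vk := by positivity
  have hC0 : 0 ≤ C := by positivity
  have hℓn : 0 < P.L ^ k := pow_pos P.L_pos k
  have hℓc : ((P.L ^ k : ℕ) : ℝ) = ℓ := by rw [hℓ]; push_cast; rfl
  have hcard : ((Finset.univ : Finset (Fin P.d → Fin (P.L ^ k))).card : ℝ) = Vk := by
    rw [Finset.card_univ, Fintype.card_fun, Fintype.card_fin, Fintype.card_fin, hVk]
    push_cast
    ring
  have ht₀ : ∀ c r, t₀ c r < P.L ^ k := fun c r => by have := (s' c r).isLt; have := hs' c r; omega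
  -- mass and longitudinal-gradient letters per fine bond
  set m : PBond P 0 → ℝ := fun b => ‖Y b‖ ^ 2 with hm
  set g : PBond P 0 → ℝ := fun b => ‖conjR (unitsField (toUField W) b) (Y ⟨b.src.shift b.dir, b.dir⟩) - Y b‖ ^ 2 with hg
  -- per coarse bond
  have hpt : ∀ c : PBond P k,
      ‖Vk⁻¹ • (gL c * (ℓ • ∑ r : Fin P.d → Fin (P.L ^ k),
            conjR (holT (unitsField (toUField W)) (Site.fibreSite 0 k c.src fun _ => ⟨0, pow_pos P.L_pos k⟩) (treeWord fun ν => ((r ν : ℕ) : ℤ))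
                * holT (unitsField (toUField W)) (Site.fibreSite 0 k c.src r) (List.replicate (t₀ c r) (c.dir, true)))
              (Y ⟨(fun z : Site P 0 => z.shift c.dir)^[t₀ c r] (Site.fibreSite 0 k c.src r), c.dir⟩)) * gR c)
        - Vk⁻¹ • (gL c * (ℓ • ∑ r : Fin P.d → Fin (P.L ^ k),
            conjR (holT (unitsField (toUField W)) (Site.fibreSite 0 k c.src fun _ => ⟨0, pow_pos P.L_pos k⟩) (treeWord fun ν => ((Function.update r c.dir (s' c r) ν : ℕ) : ℤ)))
              (Y ⟨(fun z : Site P 0 => z.shift c.dir)^[t₀ c r] (Site.fibreSite 0 k c.src r), c.dir⟩)) * gR c)‖ ^ 2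
      ≤ C ^ 2 * ℓ ^ 2 * Vk⁻¹ * ∑ r : Fin P.d → Fin (P.L ^ k), ∑ s ∈ range (P.L ^ k),
          (2 * ℓ⁻¹ * m ⟨(fun z : Site P 0 => z.shift c.dir)^[s] (Site.fibreSite 0 k c.src r), c.dir⟩
            + 2 * ℓ * g ⟨(fun z : Site P 0 => z.shift c.dir)^[s] (Site.fibreSite 0 k c.src r), c.dir⟩) := by
    intro c
    -- abbreviations
    set F₁ : (Fin P.d → Fin (P.L ^ k)) → Matrix (Fin N) (Fin N) ℂ := fun r =>
      conjR (holT (unitsField (toUField W)) (Site.fibreSite 0 k c.src fun _ => ⟨0, pow_pos P.L_pos k⟩) (treeWord fun ν => ((r ν : ℕ) : ℤ))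
          * holT (unitsField (toUField W)) (Site.fibreSite 0 k c.src r) (List.replicate (t₀ c r) (c.dir, true)))
        (Y ⟨(fun z : Site P 0 => z.shift c.dir)^[t₀ c r] (Site.fibreSite 0 k c.src r), c.dir⟩) with hF₁
    set F₂ : (Fin P.d → Fin (P.L ^ k)) → Matrix (Fin N) (Fin N) ℂ := fun r =>
      conjR (holT (unitsField (toUField W)) (Site.fibreSite 0 k c.src fun _ => ⟨0, pow_pos P.L_pos k⟩) (treeWord fun ν => ((Function.update r c.dir (s' c r) ν : ℕ) : ℤ)))
        (Y ⟨(fun z : Site P 0 => z.shift c.dir)^[t₀ c r] (Site.fibreSite 0 k c.src r), c.dir⟩) with hF₂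
    set w : (Fin P.d → Fin (P.L ^ k)) → ℝ := fun r => ‖Y ⟨(fun z : Site P 0 => z.shift c.dir)^[t₀ c r] (Site.fibreSite 0 k c.src r), c.dir⟩‖ with hw
    -- per line: the two-word defect
    have hline : ∀ r, ‖F₁ r - F₂ r‖ ≤ C * w r := fun r =>
      norm_conjR_combLine_sub_conjR_comb_le W hδ hW c.src r c.dir (t₀ c r) (s' c r) (hs' c r) _
    -- the difference is `(Vk⁻¹ℓ) • gL (Σ_r (F₁ − F₂)) gR`
    have hdiff : Vk⁻¹ • (gL c * (ℓ • ∑ r, F₁ r) * gR c) - Vk⁻¹ • (gL c * (ℓ • ∑ r, F₂ r) * gR c)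
        = (Vk⁻¹ * ℓ) • (gL c * (∑ r, (F₁ r - F₂ r)) * gR c) := by
      rw [Finset.sum_sub_distrib, Matrix.mul_sub, Matrix.sub_mul, smul_sub, ← smul_smul, ← smul_smul, Matrix.mul_smul, Matrix.smul_mul, Matrix.mul_smul, Matrix.smul_mul]
    have hnorm : ‖Vk⁻¹ • (gL c * (ℓ • ∑ r, F₁ r) * gR c) - Vk⁻¹ • (gL c * (ℓ • ∑ r, F₂ r) * gR c)‖ ≤ Vk⁻¹ * ℓ * ∑ r, C * w r := by
      rw [hdiff, norm_smul, Real.norm_eq_abs, abs_of_pos (mul_pos (inv_pos.2 hVk0) hℓ0)]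
      refine mul_le_mul_of_nonneg_left ?_ (by positivity)
      calc ‖gL c * (∑ r, (F₁ r - F₂ r)) * gR c‖ ≤ ‖gL c‖ * ‖∑ r, (F₁ r - F₂ r)‖ * ‖gR c‖ :=
            (norm_mul_le _ _).trans (mul_le_mul_of_nonneg_right (norm_mul_le _ _) (norm_nonneg _))
        _ ≤ 1 * ‖∑ r, (F₁ r - F₂ r)‖ * 1 :=
            mul_le_mul (mul_le_mul_of_nonneg_right (hgL c) (norm_nonneg _)) (hgR c) (norm_nonneg _) (mul_nonneg zero_le_one (norm_nonneg _))
        _ = ‖∑ r, (F₁ r - F₂ r)‖ := by ring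
        _ ≤ ∑ r, ‖F₁ r - F₂ r‖ := norm_sum_le _ _
        _ ≤ ∑ r, C * w r := Finset.sum_le_sum fun r _ => hline r
    -- Cauchy–Schwarz over the `Vk` lines and the 1-D trace per line
    have hw0 : ∀ r, 0 ≤ w r := fun r => norm_nonneg _
    have hcs : (∑ r, C * w r) ^ 2 ≤ Vk * ∑ r, (C * w r) ^ 2 := by
      have h1 := sq_sum_le_card_mul_sum_sq (s := (Finset.univ : Finset (Fin P.d → Fin (P.L ^ k)))) (f := fun r => C * w r)
      rwa [hcard] at h1
    have htrace : ∀ r, w r ^ 2 ≤ 2 * ((P.L ^ k : ℕ) : ℝ)⁻¹ * ∑ s ∈ range (P.L ^ k), m ⟨(fun z : Site P 0 => z.shift c.dir)^[s] (Site.fibreSite 0 k c.src r), c.dir⟩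
        + 2 * ((P.L ^ k : ℕ) : ℝ) * ∑ s ∈ range (P.L ^ k), g ⟨(fun z : Site P 0 => z.shift c.dir)^[s] (Site.fibreSite 0 k c.src r), c.dir⟩ := by
      intro r
      have h1 := normSq_apply_le_line_trace hV (fun x => Y ⟨x, c.dir⟩) (Site.fibreSite 0 k c.src r) c.dir (ht₀ c r)
      simpa only [hw, hm, hg] using h1
    have h2 : ‖Vk⁻¹ • (gL c * (ℓ • ∑ r, F₁ r) * gR c) - Vk⁻¹ • (gL c * (ℓ • ∑ r, F₂ r) * gR c)‖ ^ 2 ≤ (Vk⁻¹ * ℓ * ∑ r, C * w r) ^ 2 :=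
      pow_le_pow_left₀ (norm_nonneg _) hnorm 2
    calc _ ≤ (Vk⁻¹ * ℓ * ∑ r, C * w r) ^ 2 := h2
      _ = (Vk⁻¹ * ℓ) ^ 2 * (∑ r, C * w r) ^ 2 := by ring
      _ ≤ (Vk⁻¹ * ℓ) ^ 2 * (Vk * ∑ r, (C * w r) ^ 2) := mul_le_mul_of_nonneg_left hcs (sq_nonneg _)
      _ = C ^ 2 * ℓ ^ 2 * Vk⁻¹ * ∑ r, w r ^ 2 := by
          rw [show (∑ r, (C * w r) ^ 2) = C ^ 2 * ∑ r, w r ^ 2 by rw [Finset.mul_sum]; exact Finset.sum_congr rfl fun r _ => by ring]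
          field_simp
      _ ≤ C ^ 2 * ℓ ^ 2 * Vk⁻¹ * ∑ r, ∑ s ∈ range (P.L ^ k),
            (2 * ℓ⁻¹ * m ⟨(fun z : Site P 0 => z.shift c.dir)^[s] (Site.fibreSite 0 k c.src r), c.dir⟩
              + 2 * ℓ * g ⟨(fun z : Site P 0 => z.shift c.dir)^[s] (Site.fibreSite 0 k c.src r), c.dir⟩) := by
          refine mul_le_mul_of_nonneg_left (Finset.sum_le_sum fun r _ => ?_) (by positivity)
          have h1 := htrace r
          rw [hℓc] at h1
          rw [Finset.sum_add_distrib, Finset.mul_sum, Finset.mul_sum] at *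
          exact h1
  -- sum over the coarse bonds; count the lines
  have hlines_m := sum_block_lines h m
  have hlines_g := sum_block_lines h g
  have hsum_lines : ∑ c : PBond P k, ∑ r : Fin P.d → Fin (P.L ^ k), ∑ s ∈ range (P.L ^ k),
        (2 * ℓ⁻¹ * m ⟨(fun z : Site P 0 => z.shift c.dir)^[s] (Site.fibreSite 0 k c.src r), c.dir⟩
          + 2 * ℓ * g ⟨(fun z : Site P 0 => z.shift c.dir)^[s] (Site.fibreSite 0 k c.src r), c.dir⟩)
      = 2 * ∑ b : PBond P 0, m b + 2 * ℓ ^ 2 * ∑ b : PBond P 0, g b := by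
    simp only [Finset.sum_add_distrib, ← Finset.mul_sum]
    rw [hlines_m, hlines_g, ← hℓ]
    field_simp
  calc _ ≤ ∑ c : PBond P k, C ^ 2 * ℓ ^ 2 * Vk⁻¹ * ∑ r : Fin P.d → Fin (P.L ^ k), ∑ s ∈ range (P.L ^ k),
          (2 * ℓ⁻¹ * m ⟨(fun z : Site P 0 => z.shift c.dir)^[s] (Site.fibreSite 0 k c.src r), c.dir⟩
            + 2 * ℓ * g ⟨(fun z : Site P 0 => z.shift c.dir)^[s] (Site.fibreSite 0 k c.src r), c.dir⟩) := Finset.sum_le_sum fun c _ => hpt c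
    _ = C ^ 2 * ℓ ^ 2 * Vk⁻¹ * (2 * ∑ b : PBond P 0, m b + 2 * ℓ ^ 2 * ∑ b : PBond P 0, g b) := by rw [← Finset.mul_sum, hsum_lines]
    _ = C ^ 2 * 2 * ℓ ^ 2 * Vk⁻¹ * (∑ b : PBond P 0, m b + ℓ ^ 2 * ∑ b : PBond P 0, g b) := by ring

end Summit.QuantumFields.YangMills.Theorems.Prop7CovFaceFluxFacePiece

end
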